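import Literature.Computability.AlgebraicComplexity.ArithCircuit
import Literature.Computability.AlgebraicComplexity.StandardFamilies
import Literature.Computability.AlgebraicComplexity.SchoenhageTau
import Literature.Computability.AlgebraicComplexity.BideterminantReduction
import HarnessLib

/-!
# Determinantal ideals and Andrews' lifting of border-rank lower bounds (Andrews 2022, Thm. 3)

Topic `Literature/Computability/AlgebraicComplexity`; item `wi-17625` (family MatrixMultiplication;
consumer: route DeterminantalIdealExponent, crux `AndrewsLifting`).

Source read (held, arXiv text): R. Andrews, *On Matrix Multiplication and Polynomial Identity
Testing*, FOCS 2022 = arXiv:2208.01078 (SIAM J. Comput. 2024), §2.1 Def. 1 (algebraic circuits: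
in-degree `0` or `2`, edge constants, "The multiplicative complexity of a circuit is the number of
multiplication gates"), §2.2 Def. 4 (border computation over `𝔽(ε)`: `Φ` computes
`f + ε · g(x, ε)`, `g ∈ 𝔽[x, ε]`), §2.4 ("We denote by `I^det_{n,m,r} ⊆ 𝔽[X]` the ideal of `𝔽[X]`
generated by the `r × r` minors of `X`", `X` an `n × m` matrix of variables), Lemma 7 (cf. BCS97:
`C̲_×(⟨n,n,n⟩) ≤ R̲(⟨n,n,n⟩) ≤ 2 C̲_×(⟨n,n,n⟩)`), §3 Lemma 8 (trace-ABP gadget), Prop. 2, and: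

> **Theorem 3.** Let `𝔽` be a field of characteristic zero. The border multiplicative complexity of
> any nonzero polynomial in `I^det_{n,m,r}` is bounded from below by `(1/6) R̲(r/4)`, where
> `R̲(n) := R̲(⟨n,n,n⟩)` is the border rank of `n × n × n` matrix multiplication.

(proof: `X, Y, Z` are `r/4 × r/4` matrices, `tr(XYZ)` is a layered trace ABP on `r` vertices —
`N = n₁ + n₂ + n₃ + n₄ = 4 · (r/4)` in Lemma 8 — so `⌊r/4⌋` is the honest reading; then Prop. 2,
Baur–Strassen (Lemma 2) and Lemma 7 give `R̲(r/4) ≤ 6s`), and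

> **Corollary 1.** The border multiplicative complexity of any nonzero polynomial in `I^det_{n,m,r}`
> is bounded from below by `r²/48 - (log₂ r)/6 + 1/6` (with the Landsberg–Michałek bound).

## Content

* the determinantal ideal `I^det_{n,m,r} ⊆ 𝔽[X_{n×m}]` is the tree's `detIdeal F n m r`
  (`BideterminantReduction.lean`, Andrews–Forbes 2022 §2: the span of all `det (X.submatrix ρ γ)`);
  API added here: minors and `det_n` (`r = n = m`) lie in it, multiples of `det_n` do, and it is the
  unit ideal for `r = 0`.
* `Andrews2022_thm3` — Theorem 3 rendered in the tree's DIVISION-FREE TOTAL-COMPLEXITY currency: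
  for `𝔽` of characteristic zero and `0 ≠ f ∈ I^det_{n,m,r}`,
  `bR(⟨⌊r/4⌋, ⌊r/4⌋, ⌊r/4⌋⟩) ≤ 6 · complexity(f)`, with `bR = algBorderRank` (Bläser Def. 6.1 over
  `𝔽[ε]`, file `SchoenhageTau`) and `complexity` = least size of a fan-in-two `ArithCircuit`
  computing `f` exactly (file `ArithCircuit`). Named fact (statement only).
* Proved: `Andrews2022_thm3.andrewsLifting` — the instance `f = g · det_r ∈ I^det_{r,r,r}` in the
  exact shape of the route crux `AndrewsLifting`
  (`∀ r g, g ≠ 0 → algBorderRank (matMulTensor ℂ (r/4) (r/4) (r/4)) ≤ 6 * complexity (g * detPoly (Fin r) ℂ)`).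

## Faithfulness notes

* WEAKER THAN PRINTED, same cite. Andrews bounds the BORDER MULTIPLICATIVE complexity
  `C̲_×(f)` — the least number of multiplication gates of a circuit over `𝔽(ε)` computing
  `f + O(ε)`. Every fan-in-two `ArithCircuit` of the tree (weighted-sum gates `∑ cᵢ uᵢ` and product
  gates, fan-in `≤ 2`) computing `f` exactly over `𝔽` is such a circuit (an exact computation is a
  border computation; a weighted-sum gate is Andrews' addition gate with edge constants, a
  one-operand gate is padded with the constant `0` or `1`), and its number of product gates is at
  most its size. Hence `C̲_×(f) ≤ complexity(f)` and Theorem 3 gives the vendored inequality. The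
  tree has no multiplicative-complexity or border-circuit measure yet (route definition requests
  D1/D3); when they land, the printed strength can be vendored next to this one.
* `R̲` of Andrews = the `𝔽[ε]`/`𝔽(ε)`-algebraic border rank of BCS97 §15 (his Lemma 7 is "cf.
  BCS97"), i.e. the tree's `algBorderRank` (Bläser 2013 Def. 6.1); over `ℂ` it agrees with the
  topological border rank (not used).
* `r/4` is natural-number division (see the proof sketch above); for `r < 4` the bound is vacuous
  (`bR` of an empty tensor is `0`), as in the source.
* Lemma 8 (the trace-ABP gadget `∏ᵢ det(M_{[σᵢ],[σᵢ]}) = 1 + ε tr(X⁽¹⁾⋯X⁽ᵐ⁾) + O(ε²)`) and Prop. 2 are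
  steps of the printed proof with no consumer in the tree; they are NOT vendored as separate facts
  (D-0026: no fact without a user) — a formalisation of Theorem 3 would prove them.
* Nothing here duplicates a tree declaration: `detIdeal` (landed meanwhile in
  `BideterminantReduction.lean`, p42861), `detPoly`, `complexity`, `algBorderRank`, `matMulTensor`
  are reused.

## References

* [Andrews2022] R. Andrews, On Matrix Multiplication and Polynomial Identity Testing, FOCS 2022,
  arXiv:2208.01078; SIAM J. Comput. (2024) doi:10.1137/22m1536169 — Def. 1, Def. 4, §2.4, Lemma 7,
  Lemma 8, Prop. 2, Thm. 3, Cor. 1.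
* [Blaser2013] M. Bläser, Fast Matrix Multiplication, Theory of Computing Library, Graduate Surveys 5
  (2013), Def. 6.1 (border rank over `K[ε]`).
* [Burgisser2000] P. Bürgisser, Completeness and Reduction in Algebraic Complexity Theory (2000),
  Def. 2.1 (the circuit model of `complexity`).
-/

noncomputable section

open MvPolynomial

namespace Literature.Computability.AlgebraicComplexity

universe u

/-! ### The determinantal ideal `I^det_{n,m,r}` (the tree's `detIdeal`): API -/

section DetIdeal

variable {F : Type u} [Field F]

/-- Every `r × r` minor `det (X.submatrix ρ γ)` of the generic matrix lies in `I^det_{n,m,r}`.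
[cite: Andrews2022, §2.4] -/
theorem det_submatrix_mem_detIdeal {n m r : ℕ} (ρ : Fin r → Fin n) (γ : Fin r → Fin m) :
    ((Matrix.mvPolynomialX (Fin n) (Fin m) F).submatrix ρ γ).det ∈ detIdeal F n m r :=
  Ideal.subset_span ⟨ρ, γ, rfl⟩

/-- The generic determinant `det_n` (the tree's `detPoly`) lies in `I^det_{n,n,n}` (it is the unique
`n × n` minor). [cite: Andrews2022, §2.4] -/
theorem detPoly_mem_detIdeal (n : ℕ) : detPoly (Fin n) F ∈ detIdeal F n n n := by
  have h := det_submatrix_mem_detIdeal (F := F) (n := n) (m := n) (r := n) id id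
  simpa [detPoly] using h

/-- Multiples of `det_n` lie in `I^det_{n,n,n}`. [cite: Andrews2022, §2.4] -/
theorem mul_detPoly_mem_detIdeal (n : ℕ) (g : MvPolynomial (Fin n × Fin n) F) :
    g * detPoly (Fin n) F ∈ detIdeal F n n n :=
  Ideal.mul_mem_left _ g (detPoly_mem_detIdeal n)

/-- For `r = 0` the only minor is the empty determinant `1`, so `I^det_{n,m,0}` is the unit ideal
(the vacuous corner of Andrews' statements). [folklore] -/
theorem detIdeal_zero (n m : ℕ) : detIdeal F n m 0 = ⊤ := by
  rw [detIdeal, Ideal.eq_top_iff_one]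
  refine Ideal.subset_span ⟨Fin.elim0, Fin.elim0, ?_⟩
  simp [Matrix.det_isEmpty]

end DetIdeal

/-! ### Andrews' theorem -/

/-- **Andrews 2022, Theorem 3 (border-rank lower bounds lift to determinantal ideals), in the
tree's division-free total-complexity currency.** Printed: "Let `𝔽` be a field of characteristic
zero. The border multiplicative complexity of any nonzero polynomial in `I^det_{n,m,r}` is bounded
from below by `(1/6) R̲(r/4)`, where `R̲(n) := R̲(⟨n,n,n⟩)` is the border rank of `n × n × n` matrix
multiplication." Vendored consequence: for every field `𝔽` of characteristic zero, all `n m r` and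
every nonzero `f ∈ I^det_{n,m,r}` (`detIdeal`), the algebraic border rank over `𝔽[ε]` of the matrix
multiplication tensor `⟨⌊r/4⌋, ⌊r/4⌋, ⌊r/4⌋⟩` (`algBorderRank`, `matMulTensor`) is at most
`6 · complexity(f)`, `complexity` being the least size of a fan-in-two arithmetic circuit computing
`f` exactly — an upper bound for the number of its product gates, hence for Andrews' (border)
multiplicative complexity (module docstring). Statement only; the proof in print is Prop. 2
(AF22 straightening + Lemma 8) + Baur–Strassen + Lemma 7.
[cite: Andrews2022, Thm. 3 (with Def. 1, Def. 4, Lemma 7)] -/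
def Andrews2022_thm3 : Prop :=
  ∀ (F : Type u) [Field F] [CharZero F] (n m r : ℕ) (f : MvPolynomial (Fin n × Fin m) F),
    f ∈ detIdeal F n m r → f ≠ 0 →
      algBorderRank (matMulTensor F (r / 4) (r / 4) (r / 4)) ≤ 6 * complexity f

/-- Unfolding lemma for `Andrews2022_thm3`. [folklore] -/
theorem Andrews2022_thm3_iff :
    Andrews2022_thm3.{u} ↔
      ∀ (F : Type u) [Field F] [CharZero F] (n m r : ℕ) (f : MvPolynomial (Fin n × Fin m) F),
        f ∈ detIdeal F n m r → f ≠ 0 →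
          algBorderRank (matMulTensor F (r / 4) (r / 4) (r / 4)) ≤ 6 * complexity f :=
  Iff.rfl

/-- **The instance used by route DeterminantalIdealExponent (crux `AndrewsLifting`):** for every
`r` and every nonzero cofactor `g ∈ ℂ[X_r]`, `bR(⟨⌊r/4⌋,⌊r/4⌋,⌊r/4⌋⟩) ≤ 6 · complexity(g · det_r)` —
Theorem 3 for `f = g · det_r ∈ I^det_{r,r,r}`, nonzero because `ℂ[X]` is a domain and `det_r ≠ 0`
(Mathlib `Matrix.det_mvPolynomialX_ne_zero`). [cite: Andrews2022, Thm. 3] -/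
theorem Andrews2022_thm3.andrewsLifting (h : Andrews2022_thm3.{0}) (r : ℕ)
    (g : MvPolynomial (Fin r × Fin r) ℂ) (hg : g ≠ 0) :
    algBorderRank (matMulTensor ℂ (r / 4) (r / 4) (r / 4)) ≤
      6 * complexity (g * detPoly (Fin r) ℂ) :=
  h ℂ r r r _ (mul_detPoly_mem_detIdeal r g)
    (mul_ne_zero hg (by simpa [detPoly] using Matrix.det_mvPolynomialX_ne_zero (Fin r) ℂ))

/-- The same over any field of characteristic zero (universe-polymorphic form).
[cite: Andrews2022, Thm. 3] -/
theorem Andrews2022_thm3.mul_detPoly (h : Andrews2022_thm3.{u}) (F : Type u) [Field F] [CharZero F]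
    (r : ℕ) (g : MvPolynomial (Fin r × Fin r) F) (hg : g ≠ 0) :
    algBorderRank (matMulTensor F (r / 4) (r / 4) (r / 4)) ≤
      6 * complexity (g * detPoly (Fin r) F) :=
  h F r r r _ (mul_detPoly_mem_detIdeal r g)
    (mul_ne_zero hg (by simpa [detPoly] using Matrix.det_mvPolynomialX_ne_zero (Fin r) F))

end Literature.Computability.AlgebraicComplexity

end
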